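import Summits.Ventures.YMGap.RobustBall.CouplingSecondDerivativeOnBallS
import Summits.Ventures.YMGap.RobustBall.CouplingDerivativeCells
import HarnessLib

/-!
# Venture YMGap, track ROBUST-BALL (Y2) — TIER 2: CELLS OF THE `C²` STATEMENTS — EVERY `N ≥ 2` (Bakry–Émery one-link input) AND THE `SU(2)` WILSON
# STATE ON `ℤ⁴` ON THE WHOLE TWO-SIDED WINDOW `|β_W| < 1/6`

HONEST FRAMING. WHAT THIS IS: a venture file (cell `pub-ymgap`, track Y2 ROBUST-BALL, seat rb-p1, theorems only): hypothesis-free cells of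
`StateSecondDerivativeS` / `CouplingSecondDerivativeOnBallS` (the DLR state of a member of the tier-2 ball is `C²` along every local direction of
finite size-weighted load, and `C²` in the coupling, second derivative = the double cumulant series):
* `suN_contDiffOn_two_integral_direction_bakryEmery` — EVERY `N ≥ 2`, EVERY `d ≥ 1`, one-link input from p2's Bakry–Émery door
  (`oneLinkPoincareSUN_bakryEmery`, `oneLinkVarianceBound_bakryEmery`, `2(d−1)|β| < 1/2`): pair door
  `6(d−1)|β| e^{a'} e^{t}/(1/2 − 2(d−1)|β|) + e^{a'/2} Λ'/√(N(1/2 − 2(d−1)|β|)) < 1` ⇒ (i) `d/ds Σ'_X cov(F, V_X) = −Σ'_{(X,Y)} u₃(F; V_X; V_Y)` and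
  (ii) `s ↦ ⟨F⟩_{W+sV}` is `ContDiffOn ℝ 2` on `(−s₀, s₀)`, for every member, direction of loads `(L, L₂)`, selection and Lipschitz local `F`;
* `suN_contDiffOn_two_integral_coupling_bakryEmery` — the same door, coupling direction: every member of the ball is `C²` in the coupling;
* ★ `su2_wilson_contDiffOn_two_coupling_twoSided` — THE `SU(2)` WILSON STATE ON `ℤ⁴` IS `C²` IN THE WILSON COUPLING ON THE WHOLE TWO-SIDED WINDOW
  `|β_W| < 1/6`: for every DLR selection `b ↦ ν(b) ∈ 𝒢_b(Wilson)` on `(−1/6, 1/6)` and every Lipschitz cylinder `F`, `b ↦ ∫ F dν(b)` is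
  `ContDiffOn ℝ 2` on `(−1/6, 1/6)` (local loads from `CouplingDerivativeCells.exists_loads_su2_wilson`, glued pointwise).
WHAT THIS IS NOT: `C³` or analyticity; the one-sided star window `0 < β_W < 9/25` of ds-1's `Thresholds/CouplingSecondDerivative` is wider on the
positive side (here: two-sided, through the pair door, and for every member of the ball in the first two cells); lattice strong coupling only; nothing
about the continuum limit or a Clay-sense mass gap.
-/

noncomputable section

open MeasureTheory Function Finset ProbabilityTheory Real Filter Topology
open scoped NNReal
open Literature.Probability.LatticeModels
open Literature.Probability.LatticeModels.DobrushinMetric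
open Literature.MathematicalPhysics.QuantumLattice
open Literature.MathematicalPhysics.QuantumFieldTheory hiding ZdEdge
open Summit.QuantumFields.BalabanUV.InfraRed.StrongCouplingPoincareDoorSUN (oneLinkPoincareSUN_bakryEmery)
open Summit.QuantumFields.BalabanUV.InfraRed.StrongCouplingVarianceDoorSUN (oneLinkVarianceBound_bakryEmery)

namespace Summit.Ventures.YMGap.RobustBall

variable {d N : ℕ}

/-! ### Every `N ≥ 2`, every `d`: Bakry–Émery one-link input -/

/-- **EVERY `N ≥ 2`, EVERY `d ≥ 1` — THE STATE IS `C²` ALONG EVERY DIRECTION OF FINITE SIZE-WEIGHTED LOAD (Bakry–Émery input, hypothesis-free).**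
`2(d−1)|β| < 1/2`, pair door `6(d−1)|β| e^{a'}e^{t}/(1/2 − 2(d−1)|β|) + e^{a'/2}Λ'/√(N(1/2 − 2(d−1)|β|)) < 1`, `t > 0`; `W ∈ MemBallZdS a Λ t`,
`V ∈ MemBallZdS a_V Λ_V t` with Lipschitz witnesses of loads `(L, L₂)`, `a + s₀a_V ≤ a'`, `Λ + s₀Λ_V ≤ Λ'`; `ν(s) ∈ 𝒢(W + sV)` on `|s| ≤ s₀`; `F` bounded
measurable local Frobenius-Lipschitz.  Then (i) `d/ds Σ'_X cov_{ν(s)}(F, V_X) = −Σ'_{(X,Y)} u₃^{ν(s)}(F; V_X; V_Y)` at every `|s| < s₀` and (ii)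
`s ↦ ∫ F dν(s)` is `ContDiffOn ℝ 2` on `(−s₀, s₀)`. -/
theorem suN_contDiffOn_two_integral_direction_bakryEmery (hd : 1 ≤ d) (hN : 2 ≤ N) {β a' Λ' t a Λ aV ΛV s₀ : ℝ} (ht : 0 < t)
    (hs₀ : 0 < s₀) (hb : |β| * (2 * ((d : ℝ) - 1)) < 1 / 2)
    (hρ : 6 * ((d : ℝ) - 1) * |β| * (exp a' * exp t) / (1 / 2 - |β| * (2 * ((d : ℝ) - 1))) +
      exp (a' / 2) * Λ' / Real.sqrt ((N : ℝ) * (1 / 2 - |β| * (2 * ((d : ℝ) - 1)))) < 1)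
    {W V : Potential (ZdEdge d) (Matrix.specialUnitaryGroup (Fin N) ℂ)} (hW : MemBallZdS a Λ t W) (hV : MemBallZdS aV ΛV t V)
    (haV : 0 ≤ aV) (hΛV : 0 ≤ ΛV) (ha' : a + s₀ * aV ≤ a') (hΛ' : Λ + s₀ * ΛV ≤ Λ')
    {lipV : Finset (ZdEdge d) → ZdEdge d → ℝ} (hlipV : ∀ X, IsLipBound suFrobDist (V X) (lipV X)) {L L₂ : ℝ}
    (hLs : ∀ e, Summable fun X : Finset (ZdEdge d) => (if e ∈ X then ∑ y ∈ X, lipV X y else 0))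
    (hL : ∀ e, ∑' X : Finset (ZdEdge d), (if e ∈ X then ∑ y ∈ X, lipV X y else 0) ≤ L)
    (hL2s : ∀ e, Summable fun X : Finset (ZdEdge d) => (if e ∈ X then X.card * ∑ y ∈ X, lipV X y else 0))
    (hL2 : ∀ e, ∑' X : Finset (ZdEdge d), (if e ∈ X then X.card * ∑ y ∈ X, lipV X y else 0) ≤ L₂)
    {ν : ℝ → Measure (LGConfig d (Matrix.specialUnitaryGroup (Fin N) ℂ))}
    (hν : ∀ s ∈ Set.Icc (-s₀) s₀, ν s ∈ perturbedGibbsMeasuresS (d := d) (fundamentalRep (Fin N)) (N * β) (W + s • V))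
    {F : LGConfig d (Matrix.specialUnitaryGroup (Fin N) ℂ) → ℝ} (hFm : Measurable F) {ΛF : Finset (ZdEdge d)}
    (hFdep : DependsOn F (↑ΛF : Set (ZdEdge d))) {MF : ℝ} (hMF : ∀ σ, |F σ| ≤ MF) {δF : ZdEdge d → ℝ}
    (hδF : IsLipBound suFrobDist F δF) :
    (∀ s ∈ Set.Ioo (-s₀) s₀, HasDerivAt (fun s => ∑' X : Finset (ZdEdge d), cov[F, V X; ν s])
      (-(∑' p : Finset (ZdEdge d) × Finset (ZdEdge d), (cov[fun U => F U * V p.1 U, V p.2; ν s] -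
        (∫ U, F U ∂(ν s)) * cov[V p.1, V p.2; ν s] - (∫ U, V p.1 U ∂(ν s)) * cov[F, V p.2; ν s]))) s) ∧
      ContDiffOn ℝ 2 (fun s => ∫ U, F U ∂(ν s)) (Set.Ioo (-s₀) s₀) := by
  obtain ⟨bb, hbdef⟩ : ∃ x : ℝ, x = |β| * (2 * ((d : ℝ) - 1)) := ⟨_, rfl⟩
  rw [← hbdef] at hb hρ
  have hNpos : (0 : ℝ) < N := by exact_mod_cast (show 0 < N by omega)
  have hgap : 0 < 1 / 2 - bb := by linarith
  have hP := oneLinkPoincareSUN_bakryEmery hN (hbdef ▸ hb)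
  have hVb := oneLinkVarianceBound_bakryEmery hN (hbdef ▸ hb)
  rw [← hbdef] at hP hVb
  have hc : (0 : ℝ) ≤ 1 / ((N : ℝ) * (1 / 2 - bb)) := by positivity
  have hv : (0 : ℝ) ≤ (N : ℝ) / (1 / 2 - bb) := by positivity
  have hsq1 : Real.sqrt (1 / ((N : ℝ) * (1 / 2 - bb)) * ((N : ℝ) / (1 / 2 - bb))) = 1 / (1 / 2 - bb) := by
    rw [show 1 / ((N : ℝ) * (1 / 2 - bb)) * ((N : ℝ) / (1 / 2 - bb)) = (1 / (1 / 2 - bb)) ^ 2 by field_simp,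
      Real.sqrt_sq (by positivity)]
  have hsq2 : Real.sqrt (1 / ((N : ℝ) * (1 / 2 - bb))) = 1 / Real.sqrt ((N : ℝ) * (1 / 2 - bb)) := by
    rw [Real.sqrt_div' _ (mul_nonneg hNpos.le hgap.le), Real.sqrt_one]
  have hρeq : 6 * ((d : ℝ) - 1) * |β| * (exp a' * exp t * Real.sqrt (1 / ((N : ℝ) * (1 / 2 - bb)) * ((N : ℝ) / (1 / 2 - bb)))) +
      exp (a' / 2) * Real.sqrt (1 / ((N : ℝ) * (1 / 2 - bb))) * Λ' =
      6 * ((d : ℝ) - 1) * |β| * (exp a' * exp t) / (1 / 2 - bb) + exp (a' / 2) * Λ' / Real.sqrt ((N : ℝ) * (1 / 2 - bb)) := by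
    rw [hsq1, hsq2]; ring
  have hρ' : 6 * ((d : ℝ) - 1) * |β| * (exp a' * exp t * Real.sqrt (1 / ((N : ℝ) * (1 / 2 - bb)) * ((N : ℝ) / (1 / 2 - bb)))) +
      exp (a' / 2) * Real.sqrt (1 / ((N : ℝ) * (1 / 2 - bb))) * Λ' < 1 := by rw [hρeq]; exact hρ
  have key := hasDerivAt_tsum_cov_direction_S hd (by omega) hc hv (le_of_eq hbdef.symm) (fun B hB => hP B hB) (fun B hB => hVb B hB) ht hρ'
    hW hV haV hΛV hs₀ ha' hΛ' hlipV hLs hL hL2s hL2 hV.continuous hV.dependsOn hlipV hLs hL hL2s hL2 hν hFm hFdep hMF hδF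
  exact ⟨key.1, contDiffOn_two_integral_direction_S hd (by omega) hc hv (le_of_eq hbdef.symm) (fun B hB => hP B hB) (fun B hB => hVb B hB)
    ht hρ' hW hV haV hΛV hs₀ ha' hΛ' hlipV hLs hL hL2s hL2 hν hFm hFdep hMF hδF⟩

/-- **EVERY `N ≥ 2`, EVERY `d ≥ 1` — EVERY MEMBER OF THE WEIGHTED BALL IS `C²` IN THE COUPLING (Bakry–Émery input, hypothesis-free).**  As above
with `a + s₀|κ|·4(d−1)N ≤ a'`, `Λ + s₀|κ|·e^{t}8(d−1)√N ≤ Λ'`, selections `ν(s) ∈ 𝒢_{Nβ + sκ}(W)` on `|s| ≤ s₀`: `s ↦ ∫ F dν(s)` is `ContDiffOn ℝ 2`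
on `(−s₀, s₀)` (second derivative = the double plaquette-cumulant series, `contDiffOn_two_integral_coupling_S`). -/
theorem suN_contDiffOn_two_integral_coupling_bakryEmery (hd : 1 ≤ d) (hN : 2 ≤ N) {β a' Λ' t a Λ s₀ κ : ℝ} (ht : 0 < t) (hs₀ : 0 < s₀)
    (hb : |β| * (2 * ((d : ℝ) - 1)) < 1 / 2)
    (hρ : 6 * ((d : ℝ) - 1) * |β| * (exp a' * exp t) / (1 / 2 - |β| * (2 * ((d : ℝ) - 1))) +
      exp (a' / 2) * Λ' / Real.sqrt ((N : ℝ) * (1 / 2 - |β| * (2 * ((d : ℝ) - 1)))) < 1)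
    {W : Potential (ZdEdge d) (Matrix.specialUnitaryGroup (Fin N) ℂ)} (hW : MemBallZdS a Λ t W)
    (ha' : a + s₀ * (|κ| * (4 * ((d : ℝ) - 1) * N)) ≤ a') (hΛ' : Λ + s₀ * (|κ| * (exp t * (8 * ((d : ℝ) - 1) * Real.sqrt N))) ≤ Λ')
    {ν : ℝ → Measure (LGConfig d (Matrix.specialUnitaryGroup (Fin N) ℂ))}
    (hν : ∀ s ∈ Set.Icc (-s₀) s₀, ν s ∈ perturbedGibbsMeasuresS (d := d) (fundamentalRep (Fin N)) (N * β + s * κ) W)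
    {F : LGConfig d (Matrix.specialUnitaryGroup (Fin N) ℂ) → ℝ} (hFm : Measurable F) {ΛF : Finset (ZdEdge d)}
    (hFdep : DependsOn F (↑ΛF : Set (ZdEdge d))) {MF : ℝ} (hMF : ∀ σ, |F σ| ≤ MF) {δF : ZdEdge d → ℝ}
    (hδF : IsLipBound suFrobDist F δF) :
    ContDiffOn ℝ 2 (fun s => ∫ U, F U ∂(ν s)) (Set.Ioo (-s₀) s₀) := by
  obtain ⟨bb, hbdef⟩ : ∃ x : ℝ, x = |β| * (2 * ((d : ℝ) - 1)) := ⟨_, rfl⟩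
  rw [← hbdef] at hb hρ
  have hNpos : (0 : ℝ) < N := by exact_mod_cast (show 0 < N by omega)
  have hgap : 0 < 1 / 2 - bb := by linarith
  have hP := oneLinkPoincareSUN_bakryEmery hN (hbdef ▸ hb)
  have hVb := oneLinkVarianceBound_bakryEmery hN (hbdef ▸ hb)
  rw [← hbdef] at hP hVb
  have hc : (0 : ℝ) ≤ 1 / ((N : ℝ) * (1 / 2 - bb)) := by positivity
  have hv : (0 : ℝ) ≤ (N : ℝ) / (1 / 2 - bb) := by positivity
  have hsq1 : Real.sqrt (1 / ((N : ℝ) * (1 / 2 - bb)) * ((N : ℝ) / (1 / 2 - bb))) = 1 / (1 / 2 - bb) := by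
    rw [show 1 / ((N : ℝ) * (1 / 2 - bb)) * ((N : ℝ) / (1 / 2 - bb)) = (1 / (1 / 2 - bb)) ^ 2 by field_simp,
      Real.sqrt_sq (by positivity)]
  have hsq2 : Real.sqrt (1 / ((N : ℝ) * (1 / 2 - bb))) = 1 / Real.sqrt ((N : ℝ) * (1 / 2 - bb)) := by
    rw [Real.sqrt_div' _ (mul_nonneg hNpos.le hgap.le), Real.sqrt_one]
  have hρeq : 6 * ((d : ℝ) - 1) * |β| * (exp a' * exp t * Real.sqrt (1 / ((N : ℝ) * (1 / 2 - bb)) * ((N : ℝ) / (1 / 2 - bb)))) +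
      exp (a' / 2) * Real.sqrt (1 / ((N : ℝ) * (1 / 2 - bb))) * Λ' =
      6 * ((d : ℝ) - 1) * |β| * (exp a' * exp t) / (1 / 2 - bb) + exp (a' / 2) * Λ' / Real.sqrt ((N : ℝ) * (1 / 2 - bb)) := by
    rw [hsq1, hsq2]; ring
  have hρ' : 6 * ((d : ℝ) - 1) * |β| * (exp a' * exp t * Real.sqrt (1 / ((N : ℝ) * (1 / 2 - bb)) * ((N : ℝ) / (1 / 2 - bb)))) +
      exp (a' / 2) * Real.sqrt (1 / ((N : ℝ) * (1 / 2 - bb))) * Λ' < 1 := by rw [hρeq]; exact hρ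
  exact (contDiffOn_two_integral_coupling_S hd (by omega) hc hv (le_of_eq hbdef.symm) (fun B hB => hP B hB) (fun B hB => hVb B hB) ht hρ'
    hW hs₀ ha' hΛ' hν hFm hFdep hMF hδF).2.2

/-! ### The `SU(2)` Wilson state on `ℤ⁴`: the whole two-sided window `|β_W| < 1/6` -/

/-- ★ **THE `SU(2)` WILSON STATE ON `ℤ⁴` IS `C²` IN THE COUPLING ON THE WHOLE TWO-SIDED WINDOW `|β_W| < 1/6`.**  For every selection
`ν(b) ∈ 𝒢_b(Wilson)` on `b ∈ (−1/6, 1/6)` (bare coupling `b/2`) and every Lipschitz cylinder `F`, `b ↦ ∫ F dν(b)` is `ContDiffOn ℝ 2` on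
`(−1/6, 1/6)` (at each `β_W`: loads `s₀` of `exists_loads_su2_wilson`, the member `W = 0`, and `su2_contDiffOn_two_integral_coupling_dim4` on
`(β_W − s₀, β_W + s₀)`; the second derivative is the continuous double plaquette-cumulant series).  Relation to the cell's other `C²` statement:
ds-1's one-sided star-window result `Thresholds/CouplingSecondDerivative.su2_contDiffOn_two_integral_9_25` (`0 < β_W < 9/25`) stands and is wider on
the positive side; the new information here is the two-sided window (including `β_W ≤ 0`) and a second, independent route (pair door on the ball). -/
theorem su2_wilson_contDiffOn_two_coupling_twoSided {ν : ℝ → Measure (LGConfig 4 (Matrix.specialUnitaryGroup (Fin 2) ℂ))}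
    (hν : ∀ b ∈ Set.Ioo (-(1 / 6 : ℝ)) (1 / 6), ν b ∈ perturbedGibbsMeasuresS (d := 4) (fundamentalRep (Fin 2)) (2 * (b / 4)) 0)
    {F : LGConfig 4 (Matrix.specialUnitaryGroup (Fin 2) ℂ) → ℝ} {ΛF : Finset (ZdEdge 4)} {KF : ℝ≥0}
    (hF : IsLipschitzCylinder (fundamentalRep (Fin 2)) F ΛF KF) :
    ContDiffOn ℝ 2 (fun b => ∫ U, F U ∂(ν b)) (Set.Ioo (-(1 / 6 : ℝ)) (1 / 6)) := by
  intro βW hβ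
  have habs : |βW| < 1 / 6 := abs_lt.2 ⟨hβ.1, hβ.2⟩
  obtain ⟨s₀, hs₀, hgap, hdoor⟩ := exists_loads_su2_wilson habs
  -- the re-centred selection `s ↦ ν(β_W + s)` on `|s| ≤ s₀`
  have hν' : ∀ s ∈ Set.Icc (-s₀) s₀, ν (βW + s) ∈
      perturbedGibbsMeasuresS (d := 4) (fundamentalRep (Fin 2)) (2 * ((βW + s) / 4)) 0 := fun s hs => by
    have h1 := le_abs_self βW; have h2 := neg_abs_le βW
    exact hν (βW + s) ⟨by linarith [hs.1], by linarith [hs.2]⟩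
  have key : ContDiffOn ℝ 2 (fun s => ∫ U, F U ∂(ν (βW + s))) (Set.Ioo (-s₀) s₀) :=
    su2_contDiffOn_two_integral_coupling_dim4 (a := 0) (Λ := 0) (a' := 12 * s₀) (Λ' := 12 * Real.sqrt 2 * exp s₀ * s₀) hs₀ hs₀ hdoor
      (memBallZdS_zero le_rfl le_rfl) (by linarith) (by linarith) hν' hF
  -- translate back: `b ↦ ∫ F dν(b)` is `(s ↦ ∫ F dν(β_W + s)) ∘ (b ↦ b − β_W)` near `β_W`
  have hsub : ContDiffOn ℝ 2 (fun b : ℝ => b - βW) (Set.Ioo (βW - s₀) (βW + s₀)) := contDiffOn_id.sub contDiffOn_const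
  have hmaps : Set.MapsTo (fun b : ℝ => b - βW) (Set.Ioo (βW - s₀) (βW + s₀)) (Set.Ioo (-s₀) s₀) := fun b hb =>
    ⟨by linarith [hb.1], by linarith [hb.2]⟩
  have hat : ContDiffAt ℝ 2 ((fun s => ∫ U, F U ∂(ν (βW + s))) ∘ fun b : ℝ => b - βW) βW :=
    (key.comp hsub hmaps).contDiffAt (Ioo_mem_nhds (by linarith) (by linarith))
  refine (hat.congr_of_eventuallyEq (Eventually.of_forall fun b => ?_)).contDiffWithinAt
  simp only [Function.comp_apply, add_sub_cancel]

end Summit.Ventures.YMGap.RobustBall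

end
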